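import Literature.AnabelianGeometry.SemiGraphs.SurfaceTypeModels
import Literature.AnabelianGeometry.SemiGraphs.SurfaceTypeQuasiCoherent
import Literature.AnabelianGeometry.SemiGraphs.SurfaceTypeTotallyElevated
import Literature.AnabelianGeometry.SemiGraphs.ProSigmaCuspInertiaMalnormalHolds
import Literature.AnabelianGeometry.SemiGraphs.ProSigmaClosedSurfaceSlimCore
import HarnessLib

/-!
# [SemiAnbd] Example 2.10: the proved conjuncts fire at the model (joint non-vacuity)

Mochizuki, *Semi-graphs of anabelioids*, Publ. RIMS **42** (2006) 221–322, Example 2.10 p. 31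
[cite: MochizukiSemiAnbd2006, Ex. 2.10 p.31]: a semi-graph of anabelioids of surface type "is coherent,
totally elevated, totally universally sub-coverticial, totally estranged, and verticially slim".  The
tree proves conjuncts (1) coherent (`isCoherent_of_isOfSurfaceType`), (2) totally elevated
(`isTotallyElevated_of_isOfSurfaceType`), (4) totally estranged (`example_2_10_totallyEstranged`) and
(5) verticially slim (`isVerticiallySlim_of_isOfSurfaceType'`) from the hypothesis `IsOfSurfaceType Σ`
(+ `EveryEdgeAbuts` for (1), (2)), and `SurfaceTypeModels.lean` gives that hypothesis a model (the
semi-graph of anabelioids of a smooth `r`-pointed curve of genus `g`).  This proof-only file records the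
composite: for every nonempty set of primes `Σ` and hyperbolic `(g, r)` there is ONE connected
semi-graph of anabelioids with one vertex and `r` open edges which is simultaneously of surface
type, coherent, totally elevated, totally estranged and verticially slim — so these five predicates
of [SemiAnbd] Def. 2.3 / 2.4, as typed in the tree, are jointly satisfiable in the presence of edges
(for `r ≥ 1`; cf. the referee findings on shared cusps that shaped `IsOfSurfaceType`).  A model
certifies satisfiability only; nothing here takes a side on [IUTchIII] Cor. 3.12.  Theorems only.
-/

namespace Literature.AnabelianGeometry.SemiGraphs.SemiGraphOfAnabelioids

open Literature.GroupTheory.CombinatorialGroupTheory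

/-- **Example 2.10 (1), (2), (4), (5) hold together at a model**: for every nonempty set of primes
`Σ` and every hyperbolic `(g, r)` there is a connected semi-graph of anabelioids with exactly one
vertex and `r` edges, all open and abutting to the vertex, which is of surface type AND coherent,
totally elevated, totally estranged and verticially slim (the model of `exists_isOfSurfaceType` fed
to the tree's proofs of the four conjuncts). [cite: MochizukiSemiAnbd2006, Ex. 2.10 p.31] -/
theorem exists_isOfSurfaceType_coherent_elevated_estranged_slim (Sigma : Set ℕ)
    (hSigma : Sigma.Nonempty ∧ ∀ p ∈ Sigma, p.Prime) (g r : ℕ)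
    (hgr : PuncturedSurfaceGroup.IsHyperbolicType g r) :
    ∃ 𝒢 : SemiGraphOfAnabelioids.{0, 1, 0},
      𝒢.IsOfSurfaceType Sigma ∧ 𝒢.EveryEdgeAbuts ∧ 𝒢.IsConnected ∧
        Nonempty (𝒢.graph.Vertex ≃ Unit) ∧ Nonempty (𝒢.graph.Edge ≃ Fin r) ∧
        (∀ e, 𝒢.graph.IsOpenEdge e) ∧
        𝒢.IsCoherent ∧ 𝒢.IsTotallyElevated ∧ 𝒢.IsTotallyEstranged ∧ 𝒢.IsVerticiallySlim := by
  obtain ⟨𝒢, hS, hE, hc, hV, hEd, hopen⟩ := exists_isOfSurfaceType Sigma hSigma g r hgr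
  exact ⟨𝒢, hS, hE, hc, hV, hEd, hopen, isCoherent_of_isOfSurfaceType hE hS,
    isTotallyElevated_of_isOfSurfaceType hE hS, example_2_10_totallyEstranged 𝒢 Sigma hS,
    isVerticiallySlim_of_isOfSurfaceType' 𝒢 Sigma hS⟩

/-- In particular the tree's `IsTotallyEstranged` ([SemiAnbd] Def. 2.4 (iv), "totally estranged") is
inhabited by a semi-graph of anabelioids WITH edges: for every `r` with `2 < 2g + r` there is a
totally estranged, verticially slim semi-graph of anabelioids of surface type with `r` edges, each
abutting to a vertex. [cite: MochizukiSemiAnbd2006, Def. 2.4(iv) p.26] -/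
theorem exists_isTotallyEstranged_of_isHyperbolicType (g r : ℕ)
    (hgr : PuncturedSurfaceGroup.IsHyperbolicType g r) :
    ∃ 𝒢 : SemiGraphOfAnabelioids.{0, 1, 0},
      Nonempty (𝒢.graph.Edge ≃ Fin r) ∧ 𝒢.EveryEdgeAbuts ∧ 𝒢.IsTotallyEstranged ∧
        𝒢.IsVerticiallySlim ∧ 𝒢.IsOfSurfaceType {2} := by
  have h2 : ({2} : Set ℕ).Nonempty ∧ ∀ p ∈ ({2} : Set ℕ), p.Prime :=
    ⟨⟨2, rfl⟩, fun p hp => by rw [Set.mem_singleton_iff.mp hp]; exact Nat.prime_two⟩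
  obtain ⟨𝒢, hS, hE, -, -, hEd, -, -, -, hest, hslim⟩ :=
    exists_isOfSurfaceType_coherent_elevated_estranged_slim {2} h2 g r hgr
  exact ⟨𝒢, hEd, hE, hest, hslim, hS⟩

end Literature.AnabelianGeometry.SemiGraphs.SemiGraphOfAnabelioids
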